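import Summits.BirchSwinnertonDyer.BirchSwinnertonDyer.Theorems.ManinLocalTwoThreeShimuraQuotientRational
import Summits.BirchSwinnertonDyer.BirchSwinnertonDyer.Theorems.ManinLocalTwoThreeRigidityImpliesTower
import HarnessLib

/-!
# C3/C2 cell inputs from the torsion of STEVENS' curve: no rational `3`-point (resp. `2`-point) on `W₁` ⟹ the plus index is prime
# to `3` (resp. `2`) ⟹ the `3`-adic (resp. `2`-adic) polar witness — F★ + the now-unconditional E-es-66 / E-es-66₂

Summit `BirchSwinnertonDyer`, route `ManinLocalTwoThree` (cell bsd-f2-manin), cruxes C3 `ManinPrimeToThreeAtNine` (stmt-BirchSwinnertonDyer-22968) /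
C2 `ManinOddAtFour` (stmt-…-22967); prover seat bsd-line-manin23-p1 (C2/C3 LEAD), gen 10.  Composition of
`shimuraIndexPrimeTo_of_forall_addOrderOf_ne` (`…ShimuraQuotientRational.lean`, F★ = `optimalGamma1Parametrization_cusp_rational`),
`plusIndexPrimeTo_of_shimuraIndexPrimeTo` (tree) and p2 g11's UNCONDITIONAL `threeAdicWitnessOfPlusIndexPrimeToThree_holds` /
`twoAdicWitnessOfPlusIndexOdd_holds` (`…RigidityImpliesTower.lean`, p679277: E-es-66 / E-es-66₂ are theorems).

* `plusIndexPrimeTo_of_stevens_forall_addOrderOf_ne` — F★, `D₁` optimal `X₁(N)`-datum of `W₁`, `D₀` any `X₀(N)`-datum of an isogenous `W₀`, `p` prime,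
  no rational point of order `p` on `W₁` ⟹ `PlusIndexPrimeTo p D₀.f`.
* `threeAdicPolarWitness_of_stevens_no_three_torsion` — at `9 ∣ N`, lattice-optimal `D₀`: Stevens' curve without a rational `3`-point ⟹
  `ThreeAdicPolarWitness W₀ W₀ D₀.f` (hypothesis weaker than gen 9's «`Ψ₃(W₀)` rootless»).
* `twoAdicPolarWitness_of_stevens_no_two_torsion` — the `4 ∣ N` twin (no rational `2`-point on `W₁`).

HONEST FRAMING: conditional on F★ only; feeds the pointwise levers `not_three_dvd_maninConstant_of_noPlusDefect_of_witness` (p668234) etc., whose other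
inputs (hnf, Kato's symbol-closure fact, `KatoCurveExists`, no plus defect) remain; C2, C3, Manin's conjecture and BSD are NOT proved.  No definitions, no sorry.
-/

set_option autoImplicit false
set_option linter.dupNamespace false

noncomputable section

open scoped Classical MatrixGroups ModularForm

open CongruenceSubgroup Complex WeierstrassCurve Literature.NumberTheory.EllipticCurves
  Literature.NumberTheory.EllipticCurves.ModularForms
open Summit.BirchSwinnertonDyer.Rank1Residual.ManinAdditive.KatoCurve

namespace Summit.BirchSwinnertonDyer.BirchSwinnertonDyer.Theorems.ManinLocalTwoThree

variable {W₁ W₀ : WeierstrassCurve ℚ} [W₁.IsElliptic] [W₀.IsElliptic] {N : ℕ} [NeZero N]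

/-- **No rational `p`-point on Stevens' curve ⟹ plus index prime to `p`** (F★-conditional): for an optimal `X₁(N)`-datum `D₁` of `W₁` and any
`X₀(N)`-datum `D₀` of an isogenous `W₀` (same newform), `PlusIndexPrimeTo p D₀.f`. [cite: ConradEdixhovenStein2003, §6.1.2 and §6.2] -/
theorem plusIndexPrimeTo_of_stevens_forall_addOrderOf_ne [W₁.IsGloballyMinimal] [W₀.IsGloballyMinimal]
    (hF : optimalGamma1Parametrization_cusp_rational)
    (D₁ : Gamma1ParametrizationData W₁ N) (D₀ : ModularParametrizationData W₀ N) (hiso : IsIsogenous W₁ W₀) (h₁ : D₁.IsOptimal)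
    {p : ℕ} (hp : p.Prime) (hT : ∀ P : (W₁.baseChange ℚ).toAffine.Point, addOrderOf P ≠ p) : PlusIndexPrimeTo p D₀.f := by
  have hf : D₁.f = D₀.f := D₁.f_eq_of_isIsogenous D₀ hiso
  rw [← hf]
  exact plusIndexPrimeTo_of_shimuraIndexPrimeTo hp D₁.f (shimuraIndexPrimeTo_of_forall_addOrderOf_ne hF D₁ h₁ hp hT)

/-- **`9 ∣ N`: Stevens' curve without a rational point of order `3` ⟹ the `3`-adic polar witness for the lattice-optimal curve**
(F★ + E-es-66, the latter unconditional since p679277). [cite: ConradEdixhovenStein2003, §6.1.2 and §6.2] -/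
theorem threeAdicPolarWitness_of_stevens_no_three_torsion [W₁.IsGloballyMinimal] [W₀.IsGloballyMinimal]
    (hF : optimalGamma1Parametrization_cusp_rational)
    (D₁ : Gamma1ParametrizationData W₁ N) (D₀ : ModularParametrizationData W₀ N) (hiso : IsIsogenous W₁ W₀) (h₁ : D₁.IsOptimal)
    (h₀ : ∀ z ∈ D₀.L.lattice, ∃ w ∈ periodLattice D₀.f, z = D₀.c * w) (h9 : 3 ^ 2 ∣ N)
    (hT : ∀ P : (W₁.baseChange ℚ).toAffine.Point, addOrderOf P ≠ 3) : ThreeAdicPolarWitness W₀ W₀ D₀.f :=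
  threeAdicWitnessOfPlusIndexPrimeToThree_holds W₀ D₀ h₀ h9
    (plusIndexPrimeTo_of_stevens_forall_addOrderOf_ne hF D₁ D₀ hiso h₁ Nat.prime_three hT)

/-- **`4 ∣ N`: Stevens' curve without a rational point of order `2` ⟹ the `2`-adic polar witness for the lattice-optimal curve**
(F★ + E-es-66₂). [cite: ConradEdixhovenStein2003, §6.1.2 and §6.2] -/
theorem twoAdicPolarWitness_of_stevens_no_two_torsion [W₁.IsGloballyMinimal] [W₀.IsGloballyMinimal]
    (hF : optimalGamma1Parametrization_cusp_rational)
    (D₁ : Gamma1ParametrizationData W₁ N) (D₀ : ModularParametrizationData W₀ N) (hiso : IsIsogenous W₁ W₀) (h₁ : D₁.IsOptimal)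
    (h₀ : ∀ z ∈ D₀.L.lattice, ∃ w ∈ periodLattice D₀.f, z = D₀.c * w) (h4 : 2 ^ 2 ∣ N)
    (hT : ∀ P : (W₁.baseChange ℚ).toAffine.Point, addOrderOf P ≠ 2) : TwoAdicPolarWitness W₀ W₀ D₀.f :=
  twoAdicWitnessOfPlusIndexOdd_holds W₀ D₀ h₀ h4
    (plusIndexPrimeTo_of_stevens_forall_addOrderOf_ne hF D₁ D₀ hiso h₁ Nat.prime_two hT)

end Summit.BirchSwinnertonDyer.BirchSwinnertonDyer.Theorems.ManinLocalTwoThree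

end
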